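import Summits.CriticalPhenomena.PercolationContinuityZ3.Theorems.PercNearOneGluingNoHeavyLowerTailIncStarRootPairEvents
import HarnessLib

/-!
# The two-separation gluing theorem for the increasing star, II: the dictionary across `{s, x}`

Support file for the Sahi programme (`--supports stmt-CriticalPhenomena-4575`, prover prim-sahi-p2 gen 23).  No definitions, no named
facts, no sorries; standard axioms.  Memo `run/shared/lean/prim/prim-sahi/FROM-prim-sahi-p2-gen22-TWO-SEPARATION-GLUING.md` §1,
`prim-sahi-p2/PROOF-E3.md` §32–§33.

Root `s`, a vertex `x ≠ s`, a near side `L` (`s, x ∉ L`); near block `V₁ = insert x L`, far block `V₂ = {y | y ∉ L ∧ y ≠ s}`.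
Unlike the dictionary of `…IncStarRootPairEvents` (gen 19), the ROOT PAIR `s(s, x)` now belongs to the FAR side: the far root-star
events `B t = {∃ u ∈ V₂, s(s,u) open ∧ u ↔ t in V₂}` allow the first step `u = x`, so that `Ρ := B x ⊇ {s(s,x) open}`.  Near events:
`A t = {∃ u ∈ L, s(s,u) open ∧ u ↔ t in V₁}` (`Λ := A x`), ports `F t = {x ↔ t in V₁}`, `F_R t = {x ↔ t in V₂}`.
On every configuration with no open pair between `L` and `V₂ ∖ {x}` (deterministic statements):
* `twoSep_conn_near`: `t ∈ V₁`:  `s ↔ t ⟺ A t ∨ (Ρ ∧ F t)`;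
* `twoSep_conn_far`:  `t ∈ V₂`:  `s ↔ t ⟺ B t ∨ (Λ ∧ F_R t)`.
Set algebra shared by both sides (`rootStar_union_portInter_eq`, `rootStar_disjoint_portDiff`, `rootStar_unionPort_inter_port`,
`rootStar_pair_inter_eq`): the root event is the DISJOINT union `A t ⊔ ((F t ∖ Λ) ∩ Ρ)` ("last visit to the separator"), and for two
far targets `S_b ∩ S_c = (B b ∩ B c) ⊔ (Λ ∩ ((B⁺ b ∩ B⁺ c) ∖ (B b ∩ B c)))` with `B⁺ t = B t ∪ F_R t`.  Finally `twoSep_indep`: near events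
(pairs inside `V₁`, root pairs into `L`) and far events (pairs inside `V₂`, root pairs into `V₂`, including `s(s,x)`) are independent, and
`isUpperSet_rootStar` feeds Harris.  The moments and THEOREM G follow in `…IncStarTwoSepMoments` / `…IncStarTwoSepGlue`.
-/

noncomputable section

namespace Summit.CriticalPhenomena.PercolationContinuityZ3.Theorems

namespace IncStar

open MeasureTheory Set Literature.Probability.Percolation Literature.Probability.LatticeModels
open scoped Classical

variable {n : ℕ}

/-! ### The dictionary with the root pair on the far side -/

section Dictionary

variable (L : Set (Fin n)) {s x : Fin n} (hxs : x ≠ s) (hsL : s ∉ L) (hxL : x ∉ L) {ω : BondConfig (Fin n)}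
  (hω : ∀ y z : Fin n, y ∈ L → z ∉ L → z ≠ s → z ≠ x → s(y, z) ∉ ω)

include hxs hsL hxL hω

/-- **Dictionary, near side** (root pair on the far side): for `t ∈ V₁ = insert x L`,
`s ↔ t ⟺ A t ∨ (Ρ ∧ F t)` where `Ρ = {∃ u ∈ V₂, s(s,u) open ∧ u ↔ x in V₂}` allows `u = x`. [this work] -/
theorem twoSep_conn_near {t : Fin n} (ht : t ∈ (insert x L : Set (Fin n))) :
    ω ∈ openConn s t ↔
      (∃ u ∈ L, s(s, u) ∈ ω ∧ ω ∈ openConnIn (insert x L) u t) ∨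
        ((∃ u ∈ {y : Fin n | y ∉ L ∧ y ≠ s}, s(s, u) ∈ ω ∧ ω ∈ openConnIn {y | y ∉ L ∧ y ≠ s} u x) ∧
          ω ∈ openConnIn (insert x L) x t) := by
  have hx1 : x ∈ (insert x L : Set (Fin n)) := Set.mem_insert x L
  have hx2 : x ∈ {y : Fin n | y ∉ L ∧ y ≠ s} := ⟨hxL, hxs⟩
  have hts : t ≠ s := by
    rintro rfl
    rcases Set.mem_insert_iff.1 ht with h | h
    · exact hxs h.symm
    · exact hsL h
  have hV := rootPair_cut_hV L (s := s) (x := x)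
  have hω₁ := rootPair_cut_hω L (s := s) (x := x) hω
  have hω₂ := rootPair_cut_hω' L (s := s) (x := x) hω
  have hU := rootPair_sides_union L hxs hsL
  constructor
  · intro h
    obtain ⟨u, hus, hsu, hc⟩ := (openConn_iff_exists_firstStep hts).1 h
    rw [← hU] at hc
    by_cases huL : u ∈ L
    · exact Or.inl ⟨u, huL, hsu,
        (IncStarCutVertex.openConnIn_union_iff_of_mem_left hV hx1 hx2 hω₁ (Set.mem_insert_of_mem x huL) ht).1 hc⟩
    · have hu2 : u ∈ {y : Fin n | y ∉ L ∧ y ≠ s} := ⟨huL, hus⟩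
      rw [Set.union_comm] at hc
      have h2 := (IncStarCutVertex.openConnIn_union_iff_of_mem_right (V₁ := {y : Fin n | y ∉ L ∧ y ≠ s})
        (V₂ := (insert x L : Set (Fin n))) (fun y hy2 hy1 => hV y hy1 hy2) hx2 hx1 hω₂ hu2 ht).1 hc
      exact Or.inr ⟨⟨u, hu2, hsu, h2.1⟩, h2.2⟩
  · rintro (⟨u, huL, hsu, hc⟩ | ⟨⟨u, hu2, hsu, hc⟩, hF⟩)
    · have hsu' : s ≠ u := fun h => hsL (h ▸ huL)
      obtain ⟨r, -⟩ := BlockExploration.exists_openWalk_of_mem_openConnIn hc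
      exact ⟨SimpleGraph.Walk.cons ((openGraph_adj ω s u).2 ⟨hsu, hsu'⟩) r⟩
    · obtain ⟨r₁, -⟩ := BlockExploration.exists_openWalk_of_mem_openConnIn hc
      obtain ⟨r₂, -⟩ := BlockExploration.exists_openWalk_of_mem_openConnIn hF
      exact ⟨SimpleGraph.Walk.cons ((openGraph_adj ω s u).2 ⟨hsu, hu2.2.symm⟩) (r₁.append r₂)⟩

/-- **Dictionary, far side** (root pair on the far side): for `t ∈ V₂` (`t ∉ L`, `t ≠ s`),
`s ↔ t ⟺ B t ∨ (Λ ∧ F_R t)` with `Λ = {∃ u ∈ L, s(s,u) open ∧ u ↔ x in V₁}`. [this work] -/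
theorem twoSep_conn_far {t : Fin n} (htL : t ∉ L) (hts : t ≠ s) :
    ω ∈ openConn s t ↔
      (∃ u ∈ {y : Fin n | y ∉ L ∧ y ≠ s}, s(s, u) ∈ ω ∧ ω ∈ openConnIn {y | y ∉ L ∧ y ≠ s} u t) ∨
        ((∃ u ∈ L, s(s, u) ∈ ω ∧ ω ∈ openConnIn (insert x L) u x) ∧ ω ∈ openConnIn {y | y ∉ L ∧ y ≠ s} x t) := by
  have hx1 : x ∈ (insert x L : Set (Fin n)) := Set.mem_insert x L
  have hx2 : x ∈ {y : Fin n | y ∉ L ∧ y ≠ s} := ⟨hxL, hxs⟩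
  have ht2 : t ∈ {y : Fin n | y ∉ L ∧ y ≠ s} := ⟨htL, hts⟩
  have hV := rootPair_cut_hV L (s := s) (x := x)
  have hω₁ := rootPair_cut_hω L (s := s) (x := x) hω
  have hω₂ := rootPair_cut_hω' L (s := s) (x := x) hω
  have hU := rootPair_sides_union L hxs hsL
  constructor
  · intro h
    obtain ⟨u, hus, hsu, hc⟩ := (openConn_iff_exists_firstStep hts).1 h
    rw [← hU] at hc
    by_cases huL : u ∈ L
    · have h2 := (IncStarCutVertex.openConnIn_union_iff_of_mem_right hV hx1 hx2 hω₁ (Set.mem_insert_of_mem x huL) ht2).1 hc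
      exact Or.inr ⟨⟨u, huL, hsu, h2.1⟩, h2.2⟩
    · have hu2 : u ∈ {y : Fin n | y ∉ L ∧ y ≠ s} := ⟨huL, hus⟩
      rw [Set.union_comm] at hc
      exact Or.inl ⟨u, hu2, hsu,
        (IncStarCutVertex.openConnIn_union_iff_of_mem_left (V₁ := {y : Fin n | y ∉ L ∧ y ≠ s})
          (V₂ := (insert x L : Set (Fin n))) (fun y hy2 hy1 => hV y hy1 hy2) hx2 hx1 hω₂ hu2 ht2).1 hc⟩
  · rintro (⟨u, hu2, hsu, hc⟩ | ⟨⟨u, huL, hsu, hc⟩, hF⟩)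
    · obtain ⟨r, -⟩ := BlockExploration.exists_openWalk_of_mem_openConnIn hc
      exact ⟨SimpleGraph.Walk.cons ((openGraph_adj ω s u).2 ⟨hsu, hu2.2.symm⟩) r⟩
    · have hsu' : s ≠ u := fun h => hsL (h ▸ huL)
      obtain ⟨r₁, -⟩ := BlockExploration.exists_openWalk_of_mem_openConnIn hc
      obtain ⟨r₂, -⟩ := BlockExploration.exists_openWalk_of_mem_openConnIn hF
      exact ⟨SimpleGraph.Walk.cons ((openGraph_adj ω s u).2 ⟨hsu, hsu'⟩) (r₁.append r₂)⟩

end Dictionary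

/-! ### Set algebra of root-star events, ports and the other side's separator event -/

section Algebra

variable (U V' : Set (Fin n)) (s x : Fin n)

/-- **Last visit to the separator.**  `A t ∪ (M ∩ F t) = A t ∪ ((F t ∖ A x) ∩ M)`: a configuration in the port event `F t = {x ↔ t in V'}`
and in the root-star event of the port `A x` is already in `A t`. [this work] -/
theorem rootStar_union_portInter_eq (t : Fin n) (M : Set (BondConfig (Fin n))) :
    {ω : BondConfig (Fin n) | ∃ u ∈ U, s(s, u) ∈ ω ∧ ω ∈ openConnIn V' u t} ∪ (M ∩ openConnIn V' x t)
      = {ω : BondConfig (Fin n) | ∃ u ∈ U, s(s, u) ∈ ω ∧ ω ∈ openConnIn V' u t}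
        ∪ ((openConnIn V' x t \ {ω : BondConfig (Fin n) | ∃ u ∈ U, s(s, u) ∈ ω ∧ ω ∈ openConnIn V' u x}) ∩ M) := by
  ext ω
  simp only [Set.mem_union, Set.mem_inter_iff, Set.mem_sdiff]
  constructor
  · rintro (h | ⟨hM, hF⟩)
    · exact Or.inl h
    · by_cases hS : ω ∈ {ω : BondConfig (Fin n) | ∃ u ∈ U, s(s, u) ∈ ω ∧ ω ∈ openConnIn V' u x}
      · exact Or.inl (rootStar_of_rootStar_port_of_openConnIn U V' ω hS hF)
      · exact Or.inr ⟨⟨hF, hS⟩, hM⟩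
  · rintro (h | ⟨⟨hF, -⟩, hM⟩)
    · exact Or.inl h
    · exact Or.inr ⟨hM, hF⟩

/-- The root-star event `A t` and the port difference `F t ∖ A x` are disjoint (`A t ∧ F t ⟹ A x`). [this work] -/
theorem rootStar_disjoint_portDiff (t : Fin n) :
    Disjoint {ω : BondConfig (Fin n) | ∃ u ∈ U, s(s, u) ∈ ω ∧ ω ∈ openConnIn V' u t}
      (openConnIn V' x t \ {ω : BondConfig (Fin n) | ∃ u ∈ U, s(s, u) ∈ ω ∧ ω ∈ openConnIn V' u x}) :=
  Set.disjoint_left.2 fun ω hA hD => hD.2 (rootStar_port_of_rootStar_of_openConnIn U V' ω hA hD.1)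
/-- The root-star event `A t` and anything inside the port difference `F t ∖ A x` are disjoint. [this work] -/
theorem rootStar_disjoint_portDiff_inter (t : Fin n) (M : Set (BondConfig (Fin n))) :
    Disjoint {ω : BondConfig (Fin n) | ∃ u ∈ U, s(s, u) ∈ ω ∧ ω ∈ openConnIn V' u t}
      ((openConnIn V' x t \ {ω : BondConfig (Fin n) | ∃ u ∈ U, s(s, u) ∈ ω ∧ ω ∈ openConnIn V' u x}) ∩ M) :=
  (rootStar_disjoint_portDiff U V' s x t).mono_right Set.inter_subset_left

/-- `(A t ∪ F t) ∩ A x = A t ∩ A x`: reaching `t` from `x` inside the block plus the root star at `x` is the root star at `t`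
(the Harris input `P(A⁺ t ∩ Λ)` of the near constraint (L2)). [this work] -/
theorem rootStar_unionPort_inter_port (t : Fin n) :
    ({ω : BondConfig (Fin n) | ∃ u ∈ U, s(s, u) ∈ ω ∧ ω ∈ openConnIn V' u t} ∪ openConnIn V' x t)
        ∩ {ω : BondConfig (Fin n) | ∃ u ∈ U, s(s, u) ∈ ω ∧ ω ∈ openConnIn V' u x}
      = {ω : BondConfig (Fin n) | ∃ u ∈ U, s(s, u) ∈ ω ∧ ω ∈ openConnIn V' u t}
        ∩ {ω : BondConfig (Fin n) | ∃ u ∈ U, s(s, u) ∈ ω ∧ ω ∈ openConnIn V' u x} := by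
  ext ω
  simp only [Set.mem_union, Set.mem_inter_iff]
  constructor
  · rintro ⟨h | hF, hS⟩
    · exact ⟨h, hS⟩
    · exact ⟨rootStar_of_rootStar_port_of_openConnIn U V' ω hS hF, hS⟩
  · rintro ⟨h, hS⟩
    exact ⟨Or.inl h, hS⟩

/-- **Two targets on one side.**  With `D t = F t ∖ A x` and any event `M` (the other side's separator event):
`(A b ∪ (D b ∩ M)) ∩ (A c ∪ (D c ∩ M)) = (A b ∩ A c) ∪ (((A b ∪ F b) ∩ (A c ∪ F c)) ∖ (A b ∩ A c)) ∩ M`. [this work] -/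
theorem rootStar_pair_inter_eq (b c : Fin n) (M : Set (BondConfig (Fin n))) :
    ({ω : BondConfig (Fin n) | ∃ u ∈ U, s(s, u) ∈ ω ∧ ω ∈ openConnIn V' u b}
        ∪ ((openConnIn V' x b \ {ω : BondConfig (Fin n) | ∃ u ∈ U, s(s, u) ∈ ω ∧ ω ∈ openConnIn V' u x}) ∩ M))
      ∩ ({ω : BondConfig (Fin n) | ∃ u ∈ U, s(s, u) ∈ ω ∧ ω ∈ openConnIn V' u c}
        ∪ ((openConnIn V' x c \ {ω : BondConfig (Fin n) | ∃ u ∈ U, s(s, u) ∈ ω ∧ ω ∈ openConnIn V' u x}) ∩ M))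
      = ({ω : BondConfig (Fin n) | ∃ u ∈ U, s(s, u) ∈ ω ∧ ω ∈ openConnIn V' u b}
          ∩ {ω : BondConfig (Fin n) | ∃ u ∈ U, s(s, u) ∈ ω ∧ ω ∈ openConnIn V' u c})
        ∪ (((({ω : BondConfig (Fin n) | ∃ u ∈ U, s(s, u) ∈ ω ∧ ω ∈ openConnIn V' u b} ∪ openConnIn V' x b)
            ∩ ({ω : BondConfig (Fin n) | ∃ u ∈ U, s(s, u) ∈ ω ∧ ω ∈ openConnIn V' u c} ∪ openConnIn V' x c))
            \ ({ω : BondConfig (Fin n) | ∃ u ∈ U, s(s, u) ∈ ω ∧ ω ∈ openConnIn V' u b}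
              ∩ {ω : BondConfig (Fin n) | ∃ u ∈ U, s(s, u) ∈ ω ∧ ω ∈ openConnIn V' u c})) ∩ M) := by
  set Bb : Set (BondConfig (Fin n)) := {ω : BondConfig (Fin n) | ∃ u ∈ U, s(s, u) ∈ ω ∧ ω ∈ openConnIn V' u b}
  set Bc : Set (BondConfig (Fin n)) := {ω : BondConfig (Fin n) | ∃ u ∈ U, s(s, u) ∈ ω ∧ ω ∈ openConnIn V' u c}
  set S : Set (BondConfig (Fin n)) := {ω : BondConfig (Fin n) | ∃ u ∈ U, s(s, u) ∈ ω ∧ ω ∈ openConnIn V' u x}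
  have fb : ∀ ω : BondConfig (Fin n), ω ∈ S → ω ∈ openConnIn V' x b → ω ∈ Bb :=
    fun ω h hF => rootStar_of_rootStar_port_of_openConnIn U V' ω h hF
  have fc : ∀ ω : BondConfig (Fin n), ω ∈ S → ω ∈ openConnIn V' x c → ω ∈ Bc :=
    fun ω h hF => rootStar_of_rootStar_port_of_openConnIn U V' ω h hF
  ext ω
  simp only [Set.mem_union, Set.mem_inter_iff, Set.mem_sdiff]
  constructor
  · rintro ⟨hB | ⟨⟨hFb, hSb⟩, hM⟩, hC | ⟨⟨hFc, hSc⟩, hM'⟩⟩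
    · exact Or.inl ⟨hB, hC⟩
    · by_cases hC : ω ∈ Bc
      · exact Or.inl ⟨hB, hC⟩
      · exact Or.inr ⟨⟨⟨Or.inl hB, Or.inr hFc⟩, fun h => hC h.2⟩, hM'⟩
    · by_cases hB : ω ∈ Bb
      · exact Or.inl ⟨hB, hC⟩
      · exact Or.inr ⟨⟨⟨Or.inr hFb, Or.inl hC⟩, fun h => hB h.1⟩, hM⟩
    · by_cases hB : ω ∈ Bb
      · by_cases hC : ω ∈ Bc
        · exact Or.inl ⟨hB, hC⟩
        · exact Or.inr ⟨⟨⟨Or.inl hB, Or.inr hFc⟩, fun h => hC h.2⟩, hM⟩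
      · exact Or.inr ⟨⟨⟨Or.inr hFb, Or.inr hFc⟩, fun h => hB h.1⟩, hM⟩
  · rintro (⟨hB, hC⟩ | ⟨⟨⟨hB | hFb, hC | hFc⟩, hnot⟩, hM⟩)
    · exact ⟨Or.inl hB, Or.inl hC⟩
    · exact absurd ⟨hB, hC⟩ hnot
    · have hS : ω ∉ S := fun hS => hnot ⟨hB, fc ω hS hFc⟩
      exact ⟨Or.inl hB, Or.inr ⟨⟨hFc, hS⟩, hM⟩⟩
    · have hS : ω ∉ S := fun hS => hnot ⟨fb ω hS hFb, hC⟩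
      exact ⟨Or.inr ⟨⟨hFb, hS⟩, hM⟩, Or.inl hC⟩
    · by_cases hS : ω ∈ S
      · exact absurd ⟨fb ω hS hFb, fc ω hS hFc⟩ hnot
      · exact ⟨Or.inr ⟨⟨hFb, hS⟩, hM⟩, Or.inr ⟨⟨hFc, hS⟩, hM⟩⟩

/-- Root-star events are increasing. [folklore] -/
theorem isUpperSet_rootStar (t : Fin n) :
    IsUpperSet {ω : BondConfig (Fin n) | ∃ u ∈ U, s(s, u) ∈ ω ∧ ω ∈ openConnIn V' u t} := by
  intro ω ω' hle h
  obtain ⟨u, hu, hsu, hc⟩ := h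
  exact ⟨u, hu, hle hsu, isUpperSet_openConnIn V' u t hle hc⟩

end Algebra

/-! ### Independence of the near and far blocks (root pair on the far side) -/

/-- **Near and far are independent.**  Events determined by the off-diagonal pairs inside `insert x L` and the root pairs into `L`,
resp. by the off-diagonal pairs inside `V₂ = {y | y ∉ L ∧ y ≠ s}` and the root pairs into `V₂` (including `s(s, x)`), are independent
under every `prodBernoulli w` (disjoint coordinate sets). [this work] -/
theorem twoSep_indep (w : Sym2 (Fin n) → unitInterval) (L : Set (Fin n)) {s x : Fin n} (hxs : x ≠ s) (hsL : s ∉ L)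
    {A B : Set (BondConfig (Fin n))}
    (hA : DeterminedBy A ({z : Sym2 (Fin n) | ¬ z.IsDiag ∧ ∀ v ∈ z, v ∈ (insert x L : Set (Fin n))} ∪ {z | ∃ u ∈ L, z = s(s, u)}))
    (hB : DeterminedBy B ({z : Sym2 (Fin n) | ¬ z.IsDiag ∧ ∀ v ∈ z, v ∈ {y : Fin n | y ∉ L ∧ y ≠ s}}
      ∪ {z | ∃ u ∈ {y : Fin n | y ∉ L ∧ y ≠ s}, z = s(s, u)})) :
    (prodBernoulli w).real (A ∩ B) = (prodBernoulli w).real A * (prodBernoulli w).real B := by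
  set V₁ : Set (Fin n) := insert x L
  set V₂ : Set (Fin n) := {y | y ∉ L ∧ y ≠ s}
  have hm : ∀ X : Set (BondConfig (Fin n)), MeasurableSet X := fun _ => MeasurableSet.of_discrete
  set KL : Set (Sym2 (Fin n)) := {z : Sym2 (Fin n) | ¬ z.IsDiag ∧ ∀ v ∈ z, v ∈ V₁} ∪ {z | ∃ u ∈ L, z = s(s, u)}
  set KR : Set (Sym2 (Fin n)) := {z : Sym2 (Fin n) | ¬ z.IsDiag ∧ ∀ v ∈ z, v ∈ V₂} ∪ {z | ∃ u ∈ V₂, z = s(s, u)}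
  have hKLR : KR ⊆ KLᶜ := by
    intro z hz hzL
    rcases hz with ⟨hzd, hz2⟩ | ⟨u, hu, rfl⟩
    · rcases hzL with ⟨-, hz1⟩ | ⟨u', hu', rfl⟩
      · revert hzd hz2 hz1
        refine Sym2.inductionOn z fun p q => ?_
        intro hzd hz2 hz1
        have hp : p = x := rootPair_cut_hV L p (hz1 p (Sym2.mem_mk_left p q)) (hz2 p (Sym2.mem_mk_left p q))
        have hq : q = x := rootPair_cut_hV L q (hz1 q (Sym2.mem_mk_right p q)) (hz2 q (Sym2.mem_mk_right p q))
        exact hzd (by rw [Sym2.mk_isDiag_iff, hp, hq])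
      · exact (hz2 s (Sym2.mem_mk_left s u')).2 rfl
    · rcases hzL with ⟨-, hz1⟩ | ⟨u', hu', h⟩
      · rcases Set.mem_insert_iff.1 (hz1 s (Sym2.mem_mk_left s u)) with h | h
        · exact hxs h.symm
        · exact hsL h
      · rw [Sym2.eq_iff] at h
        rcases h with ⟨-, rfl⟩ | ⟨-, h2⟩
        · exact hu.1 hu'
        · exact hu.2 h2
  set KLf : Finset (Sym2 (Fin n)) := Finset.univ.filter fun z => z ∈ KL with hKLf
  have hKLcoe : (↑KLf : Set (Sym2 (Fin n))) = KL := by ext z; simp [hKLf]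
  have hA' : DeterminedBy A (↑KLf : Set (Sym2 (Fin n))) := by rw [hKLcoe]; exact hA
  have hB' : DeterminedBy B (↑KLf : Set (Sym2 (Fin n)))ᶜ := by rw [hKLcoe]; exact hB.mono hKLR
  exact prodBernoulli_real_inter_of_determinedBy w KLf hA' hB' (hm _) (hm _)

/-- **Root-star events with first step anywhere in the far block are local to it**: determined by the off-diagonal pairs inside `V₂`
and the root pairs into `V₂`. (Instance of `determinedBy_rootStar`.) [this work] -/
theorem determinedBy_rootStar_far (L : Set (Fin n)) (s t : Fin n) :
    DeterminedBy {ω : BondConfig (Fin n) | ∃ u ∈ {y : Fin n | y ∉ L ∧ y ≠ s}, s(s, u) ∈ ω ∧ ω ∈ openConnIn {y | y ∉ L ∧ y ≠ s} u t}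
      ({z : Sym2 (Fin n) | ¬ z.IsDiag ∧ ∀ v ∈ z, v ∈ {y : Fin n | y ∉ L ∧ y ≠ s}}
        ∪ {z | ∃ u ∈ {y : Fin n | y ∉ L ∧ y ≠ s}, z = s(s, u)}) :=
  determinedBy_rootStar _ _ s t

/-- The far port events are local to the far block. [this work] -/
theorem determinedBy_port_far (L : Set (Fin n)) (s x t : Fin n) :
    DeterminedBy (openConnIn {y : Fin n | y ∉ L ∧ y ≠ s} x t : Set (BondConfig (Fin n)))
      ({z : Sym2 (Fin n) | ¬ z.IsDiag ∧ ∀ v ∈ z, v ∈ {y : Fin n | y ∉ L ∧ y ≠ s}}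
        ∪ {z | ∃ u ∈ {y : Fin n | y ∉ L ∧ y ≠ s}, z = s(s, u)}) :=
  (IncStarCutVertex.determinedBy_openConnIn_offDiag _ x t).mono Set.subset_union_left

/-- The near port events are local to the near block. [this work] -/
theorem determinedBy_port_near (L : Set (Fin n)) (s x t : Fin n) :
    DeterminedBy (openConnIn (insert x L) x t : Set (BondConfig (Fin n)))
      ({z : Sym2 (Fin n) | ¬ z.IsDiag ∧ ∀ v ∈ z, v ∈ (insert x L : Set (Fin n))} ∪ {z | ∃ u ∈ L, z = s(s, u)}) :=
  (IncStarCutVertex.determinedBy_openConnIn_offDiag _ x t).mono Set.subset_union_left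

/-- All far pairs avoid `L`: the far determining set lies inside `{z | ∀ v ∈ z, v ∉ L}` (used to compare weights that agree off `L`).
[this work] -/
theorem far_pairs_avoid (L : Set (Fin n)) (s : Fin n) (hsL : s ∉ L) :
    ({z : Sym2 (Fin n) | ¬ z.IsDiag ∧ ∀ v ∈ z, v ∈ {y : Fin n | y ∉ L ∧ y ≠ s}}
        ∪ {z | ∃ u ∈ {y : Fin n | y ∉ L ∧ y ≠ s}, z = s(s, u)})
      ⊆ {z : Sym2 (Fin n) | ∀ v ∈ z, v ∉ L} := by
  rintro z (⟨-, hz⟩ | ⟨u, hu, rfl⟩)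
  · exact fun v hv => (hz v hv).1
  · intro v hv
    rcases Sym2.mem_iff.1 hv with rfl | rfl
    · exact hsL
    · exact hu.1

end IncStar

end Summit.CriticalPhenomena.PercolationContinuityZ3.Theorems
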